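import Mathlib.Analysis.Calculus.SmoothSeries
import Mathlib.Analysis.Calculus.ContDiff.Bounds
import Mathlib.Analysis.Calculus.BumpFunction.InnerProduct
import Literature.Analysis.FunctionSpaces.TorusLerayHelmholtzProofs
import Literature.Analysis.FunctionSpaces.TorusTimePeriodization
import Literature.Analysis.FunctionSpaces.TorusInverseLaplacian
import HarnessLib

/-!
# Proof of the space–time smooth Leray–Helmholtz decomposition on `T^d`
(`Torus.smooth_leray_helmholtz_holds`)

Analysis/FunctionSpaces support file: the **discharge** of the named fact
`Torus.smooth_leray_helmholtz` of `TorusLerayHelmholtz` (the `[folklore]` parametric form of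
Robinson–Rodrigo–Sadowski 2016, Thm. 2.6 (ii): for `G ∈ C^∞(ℝ × T^d; ℝ^d)` the Helmholtz–Weyl
decomposition `G(t) = w(t) + ∇φ(t)`, `div w(t) = 0`, `∫ φ(t) = 0`, can be chosen jointly smooth in
`(t, x)`), on top of the fixed-time discharge `TorusLerayHelmholtzProofs`
(`Torus.smooth_helmholtz_holds`).

## The proof

The potential is taken *explicitly*, slice by slice: `φ(t) := Torus.helmholtzPotential (G t)`, the
real part of the Fourier synthesis `∑ₖ e_k ψ_k(t)` with `ψ_k(t) = (k·Ĝ(t, k))/(2πi|k|²)`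
(`Torus.helmholtzCoeff`; Robinson–Rodrigo–Sadowski 2016, proof of Thm. 2.6: `α_k = û_k·k/|k|²`),
and `w(t) := G(t) - ∇φ(t)`. All fixed-time clauses are those of `TorusLerayHelmholtzProofs`
(`Torus.helmholtzPotential_spec` is `Torus.exists_smooth_potential` for the explicit potential).
What is new is the **joint smoothness of `φ`**, i.e. that a Fourier multiplier of order `≤ 0`
applied slice-wise to a jointly smooth field is jointly smooth:

1. *Iterated time derivatives.* For `u` smooth on `ℝ × T^d`, all `∂ₜⁿu` are smooth on `ℝ × T^d`
   (`IsSmoothSpaceTimeOn.iterate_timeDeriv`), and `t ↦ 𝓕(u t)(k)` is `C^∞` with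
   `dⁿ/dtⁿ 𝓕(u t)(k) = 𝓕(∂ₜⁿu t)(k)` (`Torus.iteratedDeriv_mFourierCoeff_slice`, from the accepted
   `Torus.hasDerivAt_mFourierCoeff_slice`).
2. *Uniform decay on compact time support.* If moreover `u(t) = 0` for `t ∉ [a, b]`, then
   `‖dⁿ/dtⁿ 𝓕(u t)(k)‖ ≤ C_{n,m} (1 + |k|²)^{-m}` for all `t`, `k`
   (`Torus.exists_norm_iteratedDeriv_mFourierCoeff_slice_le`: the accepted decay
   `(1 + |k|²)ᵐ ‖â(k)‖ ≤ sup ‖(1 - Δ/4π²)ᵐ a‖` of `TorusFourierSeries` applied to `∂ₜⁿu(t)`, whose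
   iterated elliptic operator is bounded on the compact `[a, b] × T^d` and vanishes off it).
3. *Parametric smooth synthesis* (`Torus.isSmoothSpaceTimeOn_tsum_mFourier_smul`): if every
   `c_k ∈ C^∞(ℝ; V)` and `‖c_k^{(n)}(t)‖ ≤ C_{n,m}(1 + |k|²)^{-m}` uniformly in `t`, then
   `(t, x) ↦ ∑ₖ e_k(x) c_k(t)` is smooth on `ℝ × T^d`: on `ℝ × ℝ^d` each term is the product of
   `c_k ∘ fst` and `e_k ∘ proj ∘ snd`, whose `n`-th derivatives are bounded by Leibniz
   (`norm_iteratedFDeriv_smul_le`) by `2ⁿ(2π)ⁿ(1 + |k|²)ⁿ · C (1 + |k|²)^{-(n + #d)}`, summable in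
   `k`; Mathlib's `contDiff_tsum` concludes (as in the fixed-time
   `Torus.isSmooth_tsum_mFourier_smul`; Grafakos 2014, Prop. 3.3.12).
4. *Localisation.* Joint smoothness is local in `t`: near `t₀` replace `G` by `χG` with a smooth
   bump `χ = 1` on `[t₀ - 1, t₀ + 1]` supported in `[t₀ - 2, t₀ + 2]` (Mathlib `ContDiffBump`);
   the potentials of `G` and `χG` agree for `|t - t₀| < 1`, and the latter is jointly smooth by
   1–3 since `|ψ_k| ≤ ‖Ĝ(k)‖` (`Torus.norm_potentialCoeff_le`).

## Contents (all proved)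

* `Torus.IsSmoothSpaceTimeOn.timeDeriv`, `.iterate_timeDeriv`,
  `Torus.iterate_timeDeriv_eq_zero_of_forall_not_mem` (time derivatives off the support);
* `Torus.isSmoothSpaceTimeOn_tsum_mFourier_smul` (parametric synthesis) with the derivative
  bounds `Torus.norm_iteratedFDeriv_mFourier_snd_le`, `Torus.norm_iteratedFDeriv_comp_fst_le`;
* `Torus.iteratedDeriv_mFourierCoeff_slice`, `Torus.contDiff_mFourierCoeff_slice`,
  `Torus.exists_norm_iteratedDeriv_mFourierCoeff_slice_le` (parametric coefficients);
* `Torus.helmholtzCoeff`, `Torus.helmholtzPotential`, `Torus.helmholtzPotential_spec`,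
  `Torus.helmholtzPotential_eq_invLaplacian_divergence` (the explicit potential IS
  `Δ⁻¹ div G₀` in the sense of `TorusInverseLaplacian`),
  `Torus.isSmoothSpaceTimeOn_helmholtzPotential`, and `Torus.smooth_leray_helmholtz_holds`.

## Mathlib / tree search; relation to existing tree objects

Mathlib (this pin): `contDiff_tsum`, `norm_iteratedFDeriv_smul_le`,
`ContinuousLinearMap.iteratedFDeriv_comp_right`, `ContinuousMultilinearMap.norm_compContinuousLinearMap_le`,
`contDiff_of_differentiable_iteratedDeriv`, `ContDiffBump`; no parametric (in an extra real
variable) version of Fourier synthesis on `UnitAddTorus` in Mathlib (searched `mFourier.*prod`,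
`contDiff.*mFourier`: none). Tree: everything fixed-time is imported from
`TorusLerayHelmholtzProofs` / `TorusFourierSeries` (`hasDerivAt_mFourierCoeff_slice`,
`isSmoothSpaceTimeOn_iterate`, `norm_mFourierCoeff_le_of_iterate_bound`), the time cutoff from
`TorusTimePeriodization` (`IsSmoothSpaceTimeOn.cutoff`). Twins and alternatives in the tree:

* `Torus.invLaplacian` (`TorusInverseLaplacian`: `Δ⁻¹` as convolution with an integrable kernel,
  with `integral_invLaplacian`, `laplacian_invLaplacian` and the joint smoothness
  `IsSmoothSpaceTimeOn.invLaplacian` on convex time sets, used in this way by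
  `FluidPDE/Antidivergence`) gives the same potential: `helmholtzPotential G₀ = Δ⁻¹(div G₀)`
  (`helmholtzPotential_eq_invLaplacian_divergence`, proved here on Fourier coefficients), so the
  joint smoothness of the slice-wise potential could equally be read off
  `IsSmoothSpaceTimeOn.invLaplacian`; the synthesis route of this file is kept because its
  by-products (parametric synthesis, derivatives and uniform decay of slice coefficients) are
  of independent use.
* `Literature.Analysis.FluidPDE.Torus.isSmoothSpaceTimeOn_torusSynth`
  (`FluidPDE/ScalarFourierSynthesis`) is the `ℂ`-valued twin of
  `isSmoothSpaceTimeOn_tsum_mFourier_smul` on time slabs `[0, T]` (coefficient families with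
  one-sided time derivatives); a `FunctionSpaces` file cannot import it, and the global
  `V`-valued form with two-sided derivatives is what the cutoff argument here needs.
* `IsSmoothSpaceTimeOn.iterate_timeDeriv` is `IsSmoothSpaceTimeOn.iterate_timeDerivWithin`
  (`SpaceTimeSliceDerivatives`) at `S = univ`, through `timeDeriv_eq_timeDerivWithin_univ`.

## References

* J. C. Robinson, J. L. Rodrigo, W. Sadowski, *The Three-Dimensional Navier–Stokes Equations:
  Classical Theory* (CUP 2016), §2.1, Thm. 2.6 with (ii) and its proof (pp. 43–44), Def. 2.8,
  Lemma 2.9. [RobinsonRodrigoSadowskiCUP2016]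
* L. Grafakos, *Classical Fourier Analysis*, 3rd ed., GTM 249 (Springer 2014), Prop. 3.2.6 (8),
  Prop. 3.3.12. [Grafakos2014]
-/

noncomputable section

open MeasureTheory Set Filter Function UnitAddTorus Complex
open scoped Topology ENNReal InnerProductSpace ContDiff Real ComplexConjugate

namespace Literature.Analysis.FunctionSpaces.Torus

variable {d : Type*} [Fintype d] [DecidableEq d]

/-! ## Iterated time derivatives of smooth space–time fields -/

section TimeDerivatives

variable {F : Type*} [NormedAddCommGroup F] [NormedSpace ℝ F]

omit [Fintype d] [DecidableEq d] in
/-- The two-sided time derivative is the time derivative within `univ`. [folklore] -/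
theorem timeDeriv_eq_timeDerivWithin_univ (u : ℝ → UnitAddTorus d → F) :
    timeDeriv u = timeDerivWithin univ u := by
  funext t x
  simp [Torus.timeDeriv, Torus.timeDerivWithin, derivWithin_univ]

omit [DecidableEq d] in
/-- The time derivative of a field smooth on `ℝ × T^d` is smooth on `ℝ × T^d`. [folklore] -/
theorem IsSmoothSpaceTimeOn.timeDeriv {u : ℝ → UnitAddTorus d → F}
    (hu : IsSmoothSpaceTimeOn univ u) : IsSmoothSpaceTimeOn univ (Torus.timeDeriv u) := by
  rw [timeDeriv_eq_timeDerivWithin_univ]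
  exact hu.timeDerivWithin uniqueDiffOn_univ

omit [DecidableEq d] in
/-- All iterated time derivatives `∂ₜⁿu` of a field smooth on `ℝ × T^d` are smooth on
`ℝ × T^d`. [folklore] -/
theorem IsSmoothSpaceTimeOn.iterate_timeDeriv {u : ℝ → UnitAddTorus d → F}
    (hu : IsSmoothSpaceTimeOn univ u) (n : ℕ) : IsSmoothSpaceTimeOn univ (Torus.timeDeriv^[n] u) := by
  induction n with
  | zero => exact hu
  | succ n ih =>
    rw [Function.iterate_succ_apply']
    exact ih.timeDeriv

omit [Fintype d] [DecidableEq d] in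
/-- The time derivative of a field vanishing for times near `t` vanishes at `t`. [folklore] -/
theorem timeDeriv_eq_zero_of_eventuallyEq {u : ℝ → UnitAddTorus d → F} {t : ℝ}
    (h : ∀ᶠ s in 𝓝 t, u s = 0) : Torus.timeDeriv u t = 0 := by
  funext x
  have h' : (fun s => u s x) =ᶠ[𝓝 t] fun _ => (0 : F) := by
    filter_upwards [h] with s hs using by rw [hs]; rfl
  rw [Torus.timeDeriv, h'.deriv_eq, deriv_const]
  rfl

omit [Fintype d] [DecidableEq d] in
/-- **Time derivatives off the support.** If `u(t) = 0` for all `t` outside a closed time set `K`,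
then so do all iterated time derivatives `∂ₜⁿu`. [folklore] -/
theorem iterate_timeDeriv_eq_zero_of_forall_not_mem {u : ℝ → UnitAddTorus d → F} {K : Set ℝ}
    (hK : IsClosed K) (h : ∀ t ∉ K, u t = 0) (n : ℕ) : ∀ t ∉ K, (Torus.timeDeriv^[n] u) t = 0 := by
  induction n with
  | zero => exact h
  | succ n ih =>
    intro t ht
    rw [Function.iterate_succ_apply']
    refine timeDeriv_eq_zero_of_eventuallyEq ?_
    filter_upwards [hK.isOpen_compl.mem_nhds ht] with s hs using ih s hs

end TimeDerivatives

/-! ## Parametric smooth Fourier synthesis on `ℝ × T^d` -/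

section Synthesis

variable {V : Type*} [NormedAddCommGroup V] [NormedSpace ℂ V] [CompleteSpace V]

omit [DecidableEq d] in
/-- Derivative bounds for the characters as functions on `ℝ × ℝ^d` (constant in time):
`‖Dⁱ((t, y) ↦ e_k(proj y))‖ ≤ (2π(1 + |k|²))ⁱ` (from `Torus.norm_iteratedFDeriv_mFourier_proj_le`
and `‖snd‖ ≤ 1`). [folklore] -/
theorem norm_iteratedFDeriv_mFourier_snd_le (k : d → ℤ) (i : ℕ) (p : ℝ × EuclideanSpace ℝ d) :
    ‖iteratedFDeriv ℝ i (fun q : ℝ × EuclideanSpace ℝ d => mFourier k (proj q.2)) p‖ ≤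
      (2 * π * (1 + freqNormSq k)) ^ i := by
  have hcomp : (fun q : ℝ × EuclideanSpace ℝ d => mFourier k (proj q.2)) =
      (fun y : EuclideanSpace ℝ d => mFourier k (proj y)) ∘
        ⇑(ContinuousLinearMap.snd ℝ ℝ (EuclideanSpace ℝ d)) := rfl
  have hsm : ContDiff ℝ ∞ (fun y : EuclideanSpace ℝ d => mFourier k (proj y)) := isSmooth_mFourier k
  rw [hcomp, ContinuousLinearMap.iteratedFDeriv_comp_right _ hsm _ (mod_cast le_top)]
  refine (ContinuousMultilinearMap.norm_compContinuousLinearMap_le _ _).trans ?_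
  have h1 : ∏ _j : Fin i, ‖ContinuousLinearMap.snd ℝ ℝ (EuclideanSpace ℝ d)‖ ≤ 1 :=
    Finset.prod_le_one (fun _ _ => norm_nonneg _) fun _ _ => ContinuousLinearMap.norm_snd_le ..
  calc ‖iteratedFDeriv ℝ i (fun y : EuclideanSpace ℝ d => mFourier k (proj y)) p.2‖ *
        ∏ _j : Fin i, ‖ContinuousLinearMap.snd ℝ ℝ (EuclideanSpace ℝ d)‖
      ≤ (2 * π * (1 + freqNormSq k)) ^ i * 1 :=
        mul_le_mul (norm_iteratedFDeriv_mFourier_proj_le k i p.2) h1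
          (Finset.prod_nonneg fun _ _ => norm_nonneg _)
          (pow_nonneg (by nlinarith [Real.pi_pos, freqNormSq_nonneg k]) i)
    _ = (2 * π * (1 + freqNormSq k)) ^ i := mul_one _

omit [DecidableEq d] [CompleteSpace V] in
/-- Derivative bounds for time coefficients as functions on `ℝ × ℝ^d` (constant in space):
`‖Dⁱ((t, y) ↦ c(t))‖ ≤ ‖c^{(i)}(t)‖` (`‖fst‖ ≤ 1`, and `‖Dⁱc‖ = ‖c^{(i)}‖` in one variable). [folklore] -/
theorem norm_iteratedFDeriv_comp_fst_le {c : ℝ → V} (hc : ContDiff ℝ ∞ c) (i : ℕ)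
    (p : ℝ × EuclideanSpace ℝ d) :
    ‖iteratedFDeriv ℝ i (fun q : ℝ × EuclideanSpace ℝ d => c q.1) p‖ ≤ ‖iteratedDeriv i c p.1‖ := by
  have hcomp : (fun q : ℝ × EuclideanSpace ℝ d => c q.1) =
      c ∘ ⇑(ContinuousLinearMap.fst ℝ ℝ (EuclideanSpace ℝ d)) := rfl
  rw [hcomp, ContinuousLinearMap.iteratedFDeriv_comp_right _ hc _ (mod_cast le_top),
    ← norm_iteratedFDeriv_eq_norm_iteratedDeriv]
  refine (ContinuousMultilinearMap.norm_compContinuousLinearMap_le _ _).trans ?_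
  have h1 : ∏ _j : Fin i, ‖ContinuousLinearMap.fst ℝ ℝ (EuclideanSpace ℝ d)‖ ≤ 1 :=
    Finset.prod_le_one (fun _ _ => norm_nonneg _) fun _ _ => ContinuousLinearMap.norm_fst_le ..
  calc ‖iteratedFDeriv ℝ i c p.1‖ * ∏ _j : Fin i, ‖ContinuousLinearMap.fst ℝ ℝ (EuclideanSpace ℝ d)‖
      ≤ ‖iteratedFDeriv ℝ i c p.1‖ * 1 := mul_le_mul_of_nonneg_left h1 (norm_nonneg _)
    _ = ‖iteratedFDeriv ℝ i c (ContinuousLinearMap.fst ℝ ℝ (EuclideanSpace ℝ d) p)‖ := mul_one _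

omit [DecidableEq d] in
/-- **Parametric smooth Fourier synthesis on `ℝ × T^d`.** Let `c_k ∈ C^∞(ℝ; V)` (`k ∈ ℤ^d`) have
derivatives decaying faster than every power of `|k|`, uniformly in time: for all `n, m` there is
`C` with `‖c_k^{(n)}(t)‖ ≤ C (1 + |k|²)^{-m}` for all `k, t`. Then `(t, x) ↦ ∑ₖ e_k(x) • c_k(t)`
is jointly smooth on `ℝ × T^d` (termwise differentiation on `ℝ × ℝ^d`, Mathlib `contDiff_tsum`:
by Leibniz, `‖Dⁿ(c_k(t) e_k(y))‖ ≤ ∑ᵢ (n choose i) (2π(1 + |k|²))ⁱ ‖c_k^{(n-i)}(t)‖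
≤ B_n (1 + |k|²)^{-#d}`, summable; the parametric form of Grafakos 2014, Prop. 3.3.12). [folklore] -/
theorem isSmoothSpaceTimeOn_tsum_mFourier_smul {c : (d → ℤ) → ℝ → V}
    (hc : ∀ k, ContDiff ℝ ∞ (c k))
    (hb : ∀ n m : ℕ, ∃ C : ℝ, ∀ k t, ‖iteratedDeriv n (c k) t‖ ≤ C * ((1 + freqNormSq k) ^ m)⁻¹) :
    IsSmoothSpaceTimeOn univ (fun t x => ∑' k, mFourier k x • c k t) := by
  rw [IsSmoothSpaceTimeOn, univ_prod_univ, contDiffOn_univ]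
  change ContDiff ℝ ∞ (fun p : ℝ × EuclideanSpace ℝ d => ∑' k,
    (fun (k : d → ℤ) (q : ℝ × EuclideanSpace ℝ d) => mFourier k (proj q.2) • c k q.1) k p)
  have hg : ∀ k : d → ℤ, ContDiff ℝ ∞ (fun q : ℝ × EuclideanSpace ℝ d => mFourier k (proj q.2)) :=
    fun k => by
      have hsm : ContDiff ℝ ∞ (fun y : EuclideanSpace ℝ d => mFourier k (proj y)) := isSmooth_mFourier k
      exact hsm.comp contDiff_snd
  have hh : ∀ k : d → ℤ, ContDiff ℝ ∞ (fun q : ℝ × EuclideanSpace ℝ d => c k q.1) :=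
    fun k => (hc k).comp contDiff_fst
  -- the derivative bounds, order by order
  have key : ∀ n : ℕ, ∃ B : ℝ, ∀ (k : d → ℤ) (p : ℝ × EuclideanSpace ℝ d),
      ‖iteratedFDeriv ℝ n (fun q : ℝ × EuclideanSpace ℝ d => mFourier k (proj q.2) • c k q.1) p‖ ≤
        B * ((1 + freqNormSq k) ^ Fintype.card d)⁻¹ := by
    intro n
    choose C hC using fun j => hb j (n + Fintype.card d)
    refine ⟨∑ i ∈ Finset.range (n + 1), (n.choose i : ℝ) * (2 * π) ^ n * |C (n - i)|, fun k p => ?_⟩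
    have hs : 0 ≤ freqNormSq k := freqNormSq_nonneg k
    have h1 : (1 : ℝ) ≤ 2 * π * (1 + freqNormSq k) := by nlinarith [Real.two_le_pi]
    refine (norm_iteratedFDeriv_smul_le (hg k) (hh k) p (n := n) (mod_cast le_top)).trans ?_
    rw [Finset.sum_mul]
    refine Finset.sum_le_sum fun i hi => ?_
    have hin : i ≤ n := Nat.lt_succ_iff.mp (Finset.mem_range.mp hi)
    have hA : ‖iteratedFDeriv ℝ i (fun q : ℝ × EuclideanSpace ℝ d => mFourier k (proj q.2)) p‖ ≤
        (2 * π) ^ n * (1 + freqNormSq k) ^ n := by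
      rw [← mul_pow]
      exact (norm_iteratedFDeriv_mFourier_snd_le k i p).trans (pow_le_pow_right₀ h1 hin)
    have hB : ‖iteratedFDeriv ℝ (n - i) (fun q : ℝ × EuclideanSpace ℝ d => c k q.1) p‖ ≤
        |C (n - i)| * ((1 + freqNormSq k) ^ (n + Fintype.card d))⁻¹ :=
      (norm_iteratedFDeriv_comp_fst_le (hc k) (n - i) p).trans ((hC (n - i) k p.1).trans
        (mul_le_mul_of_nonneg_right (le_abs_self _) (inv_nonneg.2 (pow_nonneg (by linarith) _))))
    have hpos : 0 < (1 + freqNormSq k) ^ (n + Fintype.card d) := pow_pos (by linarith) _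
    calc (n.choose i : ℝ) *
          ‖iteratedFDeriv ℝ i (fun q : ℝ × EuclideanSpace ℝ d => mFourier k (proj q.2)) p‖ *
          ‖iteratedFDeriv ℝ (n - i) (fun q : ℝ × EuclideanSpace ℝ d => c k q.1) p‖
        ≤ (n.choose i : ℝ) * ((2 * π) ^ n * (1 + freqNormSq k) ^ n) *
            (|C (n - i)| * ((1 + freqNormSq k) ^ (n + Fintype.card d))⁻¹) :=
          mul_le_mul (mul_le_mul_of_nonneg_left hA (Nat.cast_nonneg _)) hB (norm_nonneg _)
            (mul_nonneg (Nat.cast_nonneg _) (by positivity))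
      _ = (n.choose i : ℝ) * (2 * π) ^ n * |C (n - i)| * ((1 + freqNormSq k) ^ Fintype.card d)⁻¹ := by
          rw [pow_add]
          field_simp
  choose B hB using key
  exact contDiff_tsum (v := fun n k => B n * ((1 + freqNormSq k) ^ Fintype.card d)⁻¹)
    (fun k => (hg k).smul (hh k))
    (fun n _ => summable_inv_one_add_freqNormSq_pow_card.mul_left (B n)) (fun n k p _ => hB n k p)

end Synthesis

/-! ## Parametric Fourier coefficients of smooth space–time fields -/

section Coefficients

omit [DecidableEq d] in
/-- **Iterated time derivatives of the slice Fourier coefficients**: for `u` smooth on `ℝ × T^d`,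
`dⁿ/dtⁿ 𝓕(complexify ∘ u t)(k) = 𝓕(complexify ∘ ∂ₜⁿu t)(k)` (iterate
`Torus.hasDerivAt_mFourierCoeff_slice`). [folklore] -/
theorem iteratedDeriv_mFourierCoeff_slice {u : ℝ → UnitAddTorus d → EuclideanSpace ℝ d}
    (hu : IsSmoothSpaceTimeOn univ u) (k : d → ℤ) (n : ℕ) :
    iteratedDeriv n (fun t => mFourierCoeff (EuclideanSpace.complexify ∘ u t) k) =
      fun t => mFourierCoeff (EuclideanSpace.complexify ∘ (Torus.timeDeriv^[n] u) t) k := by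
  induction n with
  | zero => simp
  | succ n ih =>
    rw [iteratedDeriv_succ, ih]
    funext t
    rw [Function.iterate_succ_apply']
    exact (hasDerivAt_mFourierCoeff_slice (hu.iterate_timeDeriv n) k t).deriv

omit [DecidableEq d] in
/-- The slice Fourier coefficients `t ↦ 𝓕(complexify ∘ u t)(k)` of a field smooth on `ℝ × T^d`
are `C^∞` in time. [folklore] -/
theorem contDiff_mFourierCoeff_slice {u : ℝ → UnitAddTorus d → EuclideanSpace ℝ d}
    (hu : IsSmoothSpaceTimeOn univ u) (k : d → ℤ) :
    ContDiff ℝ ∞ (fun t => mFourierCoeff (EuclideanSpace.complexify ∘ u t) k) := by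
  refine contDiff_of_differentiable_iteratedDeriv fun n _ => ?_
  rw [iteratedDeriv_mFourierCoeff_slice hu k n]
  exact fun t => (hasDerivAt_mFourierCoeff_slice (hu.iterate_timeDeriv n) k t).differentiableAt

omit [Fintype d] [DecidableEq d] in
/-- The Fourier coefficients of the zero field vanish. [folklore] -/
theorem mFourierCoeff_complexify_zero [Fintype d] (k : d → ℤ) :
    mFourierCoeff (EuclideanSpace.complexify ∘ (0 : UnitAddTorus d → EuclideanSpace ℝ d)) k = 0 := by
  have h : (EuclideanSpace.complexify ∘ (0 : UnitAddTorus d → EuclideanSpace ℝ d)) =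
      fun _ => (0 : EuclideanSpace ℂ d) := by
    funext x; simp
  rw [h]
  simp [mFourierCoeff]

/-- **Uniform rapid decay of all time derivatives of the slice coefficients** for a field smooth
on `ℝ × T^d` with compact time support: if `u(t) = 0` for `t ∉ [a, b]`, then for all `n, m` there
is `C` with `‖dⁿ/dtⁿ 𝓕(complexify ∘ u t)(k)‖ ≤ C (1 + |k|²)^{-m}` for all `k`, `t` (the decay
`(1 + |k|²)ᵐ ‖â(k)‖ ≤ sup ‖(1 - Δ/4π²)ᵐ a‖` of `TorusFourierSeries` for `a = ∂ₜⁿu(t)`, bounded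
uniformly on the compact `[a, b] × T^d` and `= 0` off it; Grafakos 2014, Prop. 3.2.6 (8) / §3.3.1
with a parameter). [folklore] -/
theorem exists_norm_iteratedDeriv_mFourierCoeff_slice_le {u : ℝ → UnitAddTorus d → EuclideanSpace ℝ d}
    (hu : IsSmoothSpaceTimeOn univ u) {a b : ℝ} (h0 : ∀ t ∉ Icc a b, u t = 0) (n m : ℕ) :
    ∃ C : ℝ, ∀ (k : d → ℤ) (t : ℝ),
      ‖iteratedDeriv n (fun t => mFourierCoeff (EuclideanSpace.complexify ∘ u t) k) t‖ ≤
        C * ((1 + freqNormSq k) ^ m)⁻¹ := by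
  have hw : IsSmoothSpaceTimeOn univ (Torus.timeDeriv^[n] u) := hu.iterate_timeDeriv n
  obtain ⟨K, hK⟩ := (isSmoothSpaceTimeOn_iterate hw m).exists_norm_le_of_isCompact isCompact_Icc
    (subset_univ _)
  refine ⟨max K 0, fun k t => ?_⟩
  rw [iteratedDeriv_mFourierCoeff_slice hu k n]
  by_cases ht : t ∈ Icc a b
  · refine norm_mFourierCoeff_le_of_iterate_bound (hw.isSmooth_slice (mem_univ t)) (fun x => ?_) k
    rw [← iterate_spaceTime_slice]
    exact (hK t ht x).trans (le_max_left _ _)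
  · have hz : (Torus.timeDeriv^[n] u) t = 0 :=
      iterate_timeDeriv_eq_zero_of_forall_not_mem isClosed_Icc h0 n t ht
    dsimp only
    rw [hz, mFourierCoeff_complexify_zero, norm_zero]
    exact mul_nonneg (le_max_right _ _)
      (inv_nonneg.2 (pow_nonneg (by linarith [freqNormSq_nonneg k]) _))

end Coefficients

/-! ## The explicit potential `φ₀ = Δ⁻¹ div G₀` -/

section Potential

/-- The **potential multiplier** `ψ_k(a) := (k · a(k)) / (2πi |k|²)` (`= 0` at `k = 0` through
Lean's `x / 0 = 0`): the Fourier coefficients of `Δ⁻¹ div` (Robinson–Rodrigo–Sadowski 2016, proof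
of Thm. 2.6: `g = ∑ (-iα_k) e^{ik·x}`, `α_k = û_k·k/|k|²`, here with Mathlib's characters
`e^{2πik·x}`). This is the expression estimated in `Torus.norm_potentialCoeff_le`. [cite: RobinsonRodrigoSadowskiCUP2016, Thm. 2.6 proof (p. 43)] -/
def helmholtzCoeff (a : (d → ℤ) → EuclideanSpace ℂ d) (k : d → ℤ) : ℂ :=
  (∑ j, (k j : ℂ) * a k j) / (2 * π * Complex.I * freqNormSq k)

omit [Fintype d] [DecidableEq d] in
/-- `helmholtzCoeff a k` unfolds to `(∑ⱼ kⱼ a(k)ⱼ) / (2πi|k|²)`. [folklore] -/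
theorem helmholtzCoeff_apply [Fintype d] (a : (d → ℤ) → EuclideanSpace ℂ d) (k : d → ℤ) :
    helmholtzCoeff a k = (∑ j, (k j : ℂ) * a k j) / (2 * π * Complex.I * freqNormSq k) := rfl

omit [DecidableEq d] in
/-- The potential multiplier only sees the `k`-th coefficient and is linear in it: with the
continuous linear functional `L_k(v) = (∑ⱼ kⱼ vⱼ)/(2πi|k|²)`, `helmholtzCoeff a k = L_k (a k)`. [folklore] -/
theorem helmholtzCoeff_eq_clm_apply (k : d → ℤ) :
    ∃ L : EuclideanSpace ℂ d →L[ℝ] ℂ, ∀ a : (d → ℤ) → EuclideanSpace ℂ d,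
      helmholtzCoeff a k = L (a k) := by
  refine ⟨((2 * π * Complex.I * freqNormSq k)⁻¹ •
    ∑ j, (k j : ℂ) • (EuclideanSpace.proj j : EuclideanSpace ℂ d →L[ℂ] ℂ)).restrictScalars ℝ,
    fun a => ?_⟩
  rw [helmholtzCoeff_apply, div_eq_inv_mul, ContinuousLinearMap.coe_restrictScalars',
    FunLike.coe_smul, Pi.smul_apply, smul_eq_mul]
  congr 1
  simp

omit [DecidableEq d] in
/-- `‖helmholtzCoeff a k‖ ≤ ‖a k‖` (`Torus.norm_potentialCoeff_le`). [folklore] -/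
theorem norm_helmholtzCoeff_le (a : (d → ℤ) → EuclideanSpace ℂ d) (k : d → ℤ) :
    ‖helmholtzCoeff a k‖ ≤ ‖a k‖ :=
  norm_potentialCoeff_le a k

/-- The **explicit mean-zero potential** of a real vector field `G₀` on `T^d`:
`φ₀ := Re ∑ₖ e_k ψ_k`, `ψ_k = (k·Ĝ₀(k))/(2πi|k|²)`, i.e. `φ₀ = Δ⁻¹ div G₀` with zero mean
(Robinson–Rodrigo–Sadowski 2016, proof of Thm. 2.6: the function `g` with `u = h + ∇g`). For smooth
`G₀` this is the potential of `Torus.exists_smooth_potential` (`helmholtzPotential_spec`), and it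
coincides with `Torus.invLaplacian (Torus.divergence G₀)` of `TorusInverseLaplacian`
(`helmholtzPotential_eq_invLaplacian_divergence`). [cite: RobinsonRodrigoSadowskiCUP2016, Thm. 2.6 proof (pp. 43–44)] -/
def helmholtzPotential (G₀ : UnitAddTorus d → EuclideanSpace ℝ d) (x : UnitAddTorus d) : ℝ :=
  (∑' k : d → ℤ, mFourier k x •
    helmholtzCoeff (fun k => mFourierCoeff (EuclideanSpace.complexify ∘ G₀) k) k).re

/-- **The explicit potential does the job** (same proof as `Torus.exists_smooth_potential`, for
the named potential): for smooth `G₀`, `helmholtzPotential G₀` is smooth, has zero mean, and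
`G₀ - ∇(helmholtzPotential G₀)` has transversal Fourier coefficients
(`k · 𝓕(G₀ - ∇φ₀)(k) = 0` for all `k`). [cite: RobinsonRodrigoSadowskiCUP2016, Thm. 2.6 proof (pp. 43–44)] -/
theorem helmholtzPotential_spec {G : UnitAddTorus d → EuclideanSpace ℝ d} (hG : IsSmooth G) :
    IsSmooth (helmholtzPotential G) ∧ HasZeroMean (helmholtzPotential G) ∧
      ∀ k : d → ℤ, ∑ j, (k j : ℂ) *
        mFourierCoeff (EuclideanSpace.complexify ∘ (G - Torus.gradient (helmholtzPotential G))) k j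
          = 0 := by
  classical
  set a : (d → ℤ) → EuclideanSpace ℂ d := fun k => mFourierCoeff (EuclideanSpace.complexify ∘ G) k
    with ha
  set ψ : (d → ℤ) → ℂ := fun k => helmholtzCoeff a k with hψ
  -- rapid decay of `a`, hence of `ψ`
  have hdeca : ∀ m : ℕ, Summable fun k => (1 + freqNormSq k) ^ m * ‖a k‖ := fun m => by
    obtain ⟨K, -, hK⟩ := exists_iterate_bound hG (m + Fintype.card d)
    refine Summable.of_nonneg_of_le (fun k => mul_nonneg (pow_nonneg ?_ m) (norm_nonneg _))
      (fun k => ?_) (summable_inv_one_add_freqNormSq_pow_card.mul_left K)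
    · linarith [freqNormSq_nonneg k]
    · have hf : 0 < 1 + freqNormSq k := by linarith [freqNormSq_nonneg k]
      calc (1 + freqNormSq k) ^ m * ‖a k‖
          ≤ (1 + freqNormSq k) ^ m * (K * ((1 + freqNormSq k) ^ (m + Fintype.card d))⁻¹) :=
            mul_le_mul_of_nonneg_left (norm_mFourierCoeff_le_of_iterate_bound hG hK k)
              (pow_nonneg hf.le m)
        _ = K * ((1 + freqNormSq k) ^ Fintype.card d)⁻¹ := by
            rw [pow_add]
            field_simp
  have hdec : ∀ m : ℕ, Summable fun k => (1 + freqNormSq k) ^ m * ‖ψ k‖ := fun m =>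
    (hdeca m).of_nonneg_of_le
      (fun k => mul_nonneg (pow_nonneg (by linarith [freqNormSq_nonneg k]) m) (norm_nonneg _))
      fun k => mul_le_mul_of_nonneg_left (norm_helmholtzCoeff_le a k)
        (pow_nonneg (by linarith [freqNormSq_nonneg k]) m)
  have hs : Summable fun k => ‖ψ k‖ := by simpa using hdec 0
  have hconj : ∀ k, conj (ψ k) = ψ (-k) := fun k =>
    conj_potentialCoeff (fun k j => mFourierCoeff_complexify_neg_apply hG.integrable k j) k
  have hψ0 : ψ 0 = 0 := by simp [hψ, helmholtzCoeff_apply]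
  -- the complex potential and its real part
  set Φ : UnitAddTorus d → ℂ := fun x => ∑' k, mFourier k x • ψ k with hΦ
  have hΦs : IsSmooth Φ := isSmooth_tsum_mFourier_smul hdec
  have hre : (fun x => (((Φ x).re : ℝ) : ℂ)) = Φ :=
    funext fun x => ofReal_re_tsum_mFourier_smul hs hconj x
  have hφdef : helmholtzPotential G = fun x => (Φ x).re := rfl
  have hφs : IsSmooth (fun x => (Φ x).re) := hΦs.comp_clm Complex.reCLM
  have hφc : ∀ k, mFourierCoeff (fun x => (((Φ x).re : ℝ) : ℂ)) k = ψ k := fun k => by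
    rw [hre]
    exact mFourierCoeff_tsum_mFourier_smul hs k
  rw [hφdef]
  refine ⟨hφs, ?_, fun k => ?_⟩
  · -- zero mean: `∫ Re Φ = Re ∫ Φ = Re 𝓕Φ(0) = Re ψ 0 = 0`
    unfold HasZeroMean
    have h1 : ∫ x, (Φ x).re = (∫ x, Φ x).re := by
      simpa using (Complex.reCLM.integral_comp_comm hΦs.integrable)
    have h2 : ∫ x, Φ x = mFourierCoeff Φ 0 := by
      rw [mFourierCoeff_eq_integral_volume]
      simp [mFourier_zero]
    rw [h1, h2, mFourierCoeff_tsum_mFourier_smul hs 0, hψ0, Complex.zero_re]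
  · -- transversality of `G - ∇φ`
    have hgs : IsSmooth (Torus.gradient fun x => (Φ x).re) := hφs.gradient
    rw [complexify_comp_sub, mFourierCoeff_sub (integrable_complexify_comp hG.integrable)
      (integrable_complexify_comp hgs.integrable)]
    simp_rw [PiLp.sub_apply, mFourierCoeff_complexify_gradient_apply_eq hφs, hφc]
    exact sum_mul_sub_potential_eq_zero a k

/-- **The explicit potential is `Δ⁻¹ div`.** For smooth `G₀` on `T^d` (`d` nonempty),
`helmholtzPotential G₀ = Torus.invLaplacian (Torus.divergence G₀)`, the inverse Laplacian of
`TorusInverseLaplacian` (convolution form). Both are smooth of zero mean; on Fourier coefficients,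
transversality of `G₀ - ∇φ₀` (`helmholtzPotential_spec`) reads `k·Ĝ₀(k) = 2πi|k|² φ̂₀(k)`, while
`Δ(Δ⁻¹ div G₀) = div G₀ - ∫ div G₀ = div G₀` (`Torus.laplacian_invLaplacian`,
`Torus.integral_divergence_eq_zero`) reads `-4π²|k|² 𝓕(Δ⁻¹div G₀)(k) = 2πi k·Ĝ₀(k)`; hence the
coefficients agree off `k = 0`, and at `k = 0` both are the (vanishing) means. [folklore] -/
theorem helmholtzPotential_eq_invLaplacian_divergence [Nonempty d]
    {G : UnitAddTorus d → EuclideanSpace ℝ d} (hG : IsSmooth G) :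
    helmholtzPotential G = invLaplacian (divergence G) := by
  classical
  obtain ⟨hφ₁, hmean₁, htrans⟩ := helmholtzPotential_spec hG
  set φ₁ : UnitAddTorus d → ℝ := helmholtzPotential G with hφ₁_def
  set φ₂ : UnitAddTorus d → ℝ := invLaplacian (divergence G) with hφ₂_def
  have hdiv : IsSmooth (divergence G) := hG.divergence
  have hφ₂ : IsSmooth φ₂ := isSmooth_invLaplacian hdiv
  have hmean₂ : ∫ x, φ₂ x = 0 := integral_invLaplacian hdiv
  -- `Δφ₂ = div G`
  have hΔ₂ : ∀ x, laplacian φ₂ x = divergence G x := fun x => by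
    rw [hφ₂_def, laplacian_invLaplacian hdiv x, integral_divergence_eq_zero_holds hG, sub_zero]
  -- complexifications
  set w₁ : UnitAddTorus d → ℂ := fun y => (φ₁ y : ℂ) with hw₁_def
  set w₂ : UnitAddTorus d → ℂ := fun y => (φ₂ y : ℂ) with hw₂_def
  have hw₁ : IsSmooth w₁ := hφ₁.ofReal
  have hw₂ : IsSmooth w₂ := hφ₂.ofReal
  -- the means (`k = 0`)
  have hzero : ∀ {φ : UnitAddTorus d → ℝ}, ∫ x, φ x = 0 →
      mFourierCoeff (fun y => (φ y : ℂ)) 0 = 0 := fun {φ} hφ0 => by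
    rw [mFourierCoeff_eq_integral_conj_mul]
    simp only [mFourier_zero, ContinuousMap.one_apply, map_one, one_mul]
    rw [integral_complex_ofReal, hφ0, Complex.ofReal_zero]
  -- `k·Ĝ(k) = 2πi |k|² φ̂₁(k)` from transversality
  have h₁ : ∀ k : d → ℤ, ∑ j, (k j : ℂ) * mFourierCoeff (EuclideanSpace.complexify ∘ G) k j =
      2 * π * Complex.I * (freqNormSq k : ℂ) * mFourierCoeff w₁ k := fun k => by
    have h := htrans k
    rw [complexify_comp_sub, mFourierCoeff_sub (integrable_complexify_comp hG.integrable)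
      (integrable_complexify_comp hφ₁.gradient.integrable)] at h
    simp_rw [PiLp.sub_apply, mFourierCoeff_complexify_gradient_apply_eq hφ₁, mul_sub,
      Finset.sum_sub_distrib, sub_eq_zero] at h
    rw [h]
    have hfns : (freqNormSq k : ℂ) = ∑ j, (k j : ℂ) * (k j : ℂ) := by
      unfold freqNormSq; push_cast; exact Finset.sum_congr rfl fun j _ => sq _
    rw [hfns, Finset.mul_sum, Finset.sum_mul]
    exact Finset.sum_congr rfl fun j _ => by ring
  -- `-4π²|k|² φ̂₂(k) = 2πi k·Ĝ(k)` from `Δφ₂ = div G`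
  have h₂ : ∀ k : d → ℤ, (-(4 * Real.pi ^ 2 * freqNormSq k : ℝ) : ℂ) * mFourierCoeff w₂ k =
      2 * π * Complex.I * ∑ j, (k j : ℂ) * mFourierCoeff (EuclideanSpace.complexify ∘ G) k j :=
    fun k => by
    rw [← mFourierCoeff_laplacian_complex hw₂, ← mFourierCoeff_ofReal_divergence hG]
    congr 1
    funext y
    rw [hw₂_def, ← ofReal_laplacian hφ₂ y, hΔ₂ y]
  -- equality of all coefficients
  have hcoef : ∀ k, mFourierCoeff w₁ k = mFourierCoeff w₂ k := fun k => by
    by_cases hk : freqNormSq k = 0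
    · have hk0 : k = 0 := eq_zero_of_freqNormSq_eq_zero hk
      subst hk0
      rw [hzero hmean₁, hzero hmean₂]
    · have hne : (2 * π * Complex.I * (freqNormSq k : ℂ)) * (2 * π * Complex.I) ≠ 0 := by
        have hπ : (π : ℂ) ≠ 0 := by exact_mod_cast Real.pi_ne_zero
        have hf : (freqNormSq k : ℂ) ≠ 0 := by exact_mod_cast hk
        simp [hπ, hf, Complex.I_ne_zero]
      have key : (2 * π * Complex.I * (freqNormSq k : ℂ)) * (2 * π * Complex.I) * mFourierCoeff w₁ k =
          (2 * π * Complex.I * (freqNormSq k : ℂ)) * (2 * π * Complex.I) * mFourierCoeff w₂ k := by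
        have e₂ := h₂ k
        rw [h₁ k] at e₂
        have hI : Complex.I * Complex.I = -1 := Complex.I_mul_I
        push_cast at e₂
        linear_combination -e₂ - 4 * (π : ℂ) ^ 2 * (freqNormSq k : ℂ) * mFourierCoeff w₂ k * hI
      exact mul_left_cancel₀ hne key
  have hEq : w₁ = w₂ :=
    eq_of_forall_mFourierCoeff_eq (Complex.continuous_ofReal.comp hφ₁.continuous)
      (Complex.continuous_ofReal.comp hφ₂.continuous) hcoef
  funext x
  have hx := congrFun hEq x
  simp only [hw₁_def, hw₂_def, Complex.ofReal_inj] at hx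
  exact hx

end Potential

/-! ## Joint smoothness of the slice-wise potential, and the theorem -/

section SpaceTime

/-- **The slice-wise potential of a jointly smooth field is jointly smooth**: for
`G ∈ C^∞(ℝ × T^d; ℝ^d)`, `(t, x) ↦ helmholtzPotential (G t) x` is smooth on `ℝ × T^d`. Near a time
`t₀`, `G` is replaced by `χG` with a smooth bump `χ` (`= 1` on `[t₀ - 1, t₀ + 1]`, supported in
`[t₀ - 2, t₀ + 2]`), which does not change the potential for `|t - t₀| < 1`; the potential
coefficients `ψ_k(t) = L_k(𝓕(χG(t))(k))` of the cut-off field are `C^∞` in `t` with all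
derivatives decaying rapidly in `k` uniformly in `t`
(`exists_norm_iteratedDeriv_mFourierCoeff_slice_le`, `‖L_k‖`-free form via
`norm_helmholtzCoeff_le`), so the parametric synthesis
`isSmoothSpaceTimeOn_tsum_mFourier_smul` applies. This is the folklore statement "`Δ⁻¹ div`, a
Fourier multiplier of order `-1`, maps `C^∞(ℝ; H^s)` to itself for all `s`"
(Robinson–Rodrigo–Sadowski 2016, Thm. 2.6 (ii) and Lemma 2.9, with a parameter). [folklore] -/
theorem isSmoothSpaceTimeOn_helmholtzPotential {G : ℝ → UnitAddTorus d → EuclideanSpace ℝ d}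
    (hG : IsSmoothSpaceTimeOn univ G) :
    IsSmoothSpaceTimeOn univ (fun t => helmholtzPotential (G t)) := by
  rw [IsSmoothSpaceTimeOn, univ_prod_univ, contDiffOn_univ]
  refine contDiff_iff_contDiffAt.2 fun p => ?_
  obtain ⟨t₀, y⟩ := p
  -- smooth time cutoff around `t₀`
  let χ : ContDiffBump t₀ := ⟨1, 2, one_pos, one_lt_two⟩
  set u : ℝ → UnitAddTorus d → EuclideanSpace ℝ d := fun t x => (χ : ℝ → ℝ) t • G t x with hu_def
  have hu : IsSmoothSpaceTimeOn univ u :=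
    hG.cutoff χ.contDiff (by rw [interior_univ]; exact subset_univ _)
  have hu0 : ∀ t ∉ Icc (t₀ - 2) (t₀ + 2), u t = 0 := fun t ht => by
    refine cutoff_apply_of_eq_zero (χ.zero_of_le_dist ?_)
    change (2 : ℝ) ≤ dist t t₀
    rw [Real.dist_eq]
    rcases lt_or_ge t (t₀ - 2) with h | h
    · rw [abs_of_neg (by linarith)]
      linarith
    · have h' : t₀ + 2 < t := lt_of_not_ge fun h'' => ht ⟨h, h''⟩
      rw [abs_of_pos (by linarith)]
      linarith
  have hu1 : ∀ t ∈ Ioo (t₀ - 1) (t₀ + 1), u t = G t := fun t ht => by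
    refine cutoff_apply_of_eq_one (χ.one_of_mem_closedBall ?_)
    rw [Metric.mem_closedBall, Real.dist_eq]
    change |t - t₀| ≤ 1
    exact abs_le.2 ⟨by linarith [ht.1], by linarith [ht.2]⟩
  -- the potential coefficients of the cut-off field
  set c : (d → ℤ) → ℝ → ℂ := fun k t =>
    helmholtzCoeff (fun k => mFourierCoeff (EuclideanSpace.complexify ∘ u t) k) k with hc_def
  have hcd : ∀ (k : d → ℤ) (n : ℕ), iteratedDeriv n (c k) = fun t =>
      helmholtzCoeff (fun k => mFourierCoeff (EuclideanSpace.complexify ∘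
        (Torus.timeDeriv^[n] u) t) k) k := fun k n => by
    obtain ⟨L, hL⟩ := helmholtzCoeff_eq_clm_apply (d := d) k
    -- both sides are `L ∘ (slice coefficients of ∂ₜⁿu)`
    have hform : ∀ n : ℕ, (fun t => helmholtzCoeff (fun k =>
        mFourierCoeff (EuclideanSpace.complexify ∘ (Torus.timeDeriv^[n] u) t) k) k) =
        ⇑L ∘ fun t => mFourierCoeff (EuclideanSpace.complexify ∘ (Torus.timeDeriv^[n] u) t) k :=
      fun n => funext fun t => hL _
    induction n with
    | zero =>
      rw [iteratedDeriv_zero, hc_def]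
      rfl
    | succ n ih =>
      rw [iteratedDeriv_succ, ih, hform n, hform (n + 1)]
      funext t
      rw [Function.comp_apply, Function.iterate_succ_apply']
      exact (L.hasFDerivAt.comp_hasDerivAt t
        (hasDerivAt_mFourierCoeff_slice (hu.iterate_timeDeriv n) k t)).deriv
  have hc : ∀ k, ContDiff ℝ ∞ (c k) := fun k => by
    obtain ⟨L, hL⟩ := helmholtzCoeff_eq_clm_apply (d := d) k
    have hform : c k = ⇑L ∘ fun t => mFourierCoeff (EuclideanSpace.complexify ∘ u t) k := by
      rw [hc_def]
      exact funext fun t => hL _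
    rw [hform]
    exact L.contDiff.comp (contDiff_mFourierCoeff_slice hu k)
  have hb : ∀ n m : ℕ, ∃ C : ℝ, ∀ k t, ‖iteratedDeriv n (c k) t‖ ≤ C * ((1 + freqNormSq k) ^ m)⁻¹ := by
    intro n m
    obtain ⟨C, hC⟩ := exists_norm_iteratedDeriv_mFourierCoeff_slice_le hu hu0 n m
    refine ⟨C, fun k t => ?_⟩
    rw [hcd k n]
    refine (norm_helmholtzCoeff_le _ k).trans ?_
    have := hC k t
    rwa [iteratedDeriv_mFourierCoeff_slice hu k n] at this
  -- the cut-off potential is jointly smooth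
  have hΦ : IsSmoothSpaceTimeOn univ (fun t x => ∑' k, mFourier k x • c k t) :=
    isSmoothSpaceTimeOn_tsum_mFourier_smul hc hb
  have hφu : IsSmoothSpaceTimeOn univ (fun t x => (∑' k, mFourier k x • c k t).re) :=
    hΦ.clm_comp Complex.reCLM
  -- and agrees with the potential of `G` near `(t₀, y)`
  have heq : stLift (fun t => helmholtzPotential (G t)) =ᶠ[𝓝 (t₀, y)]
      stLift (fun t x => (∑' k, mFourier k x • c k t).re) := by
    have hn : (Ioo (t₀ - 1) (t₀ + 1)) ×ˢ (univ : Set (EuclideanSpace ℝ d)) ∈ 𝓝 (t₀, y) :=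
      prod_mem_nhds (Ioo_mem_nhds (by linarith) (by linarith)) univ_mem
    filter_upwards [hn] with q hq
    obtain ⟨t, z⟩ := q
    have ht : t ∈ Ioo (t₀ - 1) (t₀ + 1) := (mem_prod.1 hq).1
    simp only [stLift_apply, helmholtzPotential, hc_def, hu1 t ht]
  have h2 : ContDiffAt ℝ ∞ (stLift (fun t x => (∑' k, mFourier k x • c k t).re)) (t₀, y) := by
    have h := hφu
    rw [IsSmoothSpaceTimeOn, univ_prod_univ, contDiffOn_univ] at h
    exact h.contDiffAt
  exact h2.congr_of_eventuallyEq heq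

variable (d) in
/-- **Discharge of `Torus.smooth_leray_helmholtz`** (the space–time smooth Leray–Helmholtz
decomposition; Robinson–Rodrigo–Sadowski 2016, Thm. 2.6 (ii) with a smooth time parameter, as
consumed by Bruè–De Lellis 2023 §3 and Cheskidov 2023 §6): for `G ∈ C^∞(ℝ × T^d; ℝ^d)` put
`φ(t) := helmholtzPotential (G t)` (jointly smooth by `isSmoothSpaceTimeOn_helmholtzPotential`,
mean zero) and `w(t) := G(t) - ∇φ(t)` (jointly smooth, divergence free slice-wise because its
Fourier coefficients are transversal, `helmholtzPotential_spec`); then `G = w + ∇φ`. [folklore] -/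
theorem smooth_leray_helmholtz_holds : smooth_leray_helmholtz d := by
  intro G hG
  have hφ : IsSmoothSpaceTimeOn univ (fun t => helmholtzPotential (G t)) :=
    isSmoothSpaceTimeOn_helmholtzPotential hG
  have hspec : ∀ t, IsSmooth (helmholtzPotential (G t)) ∧ HasZeroMean (helmholtzPotential (G t)) ∧
      ∀ k : d → ℤ, ∑ j, (k j : ℂ) * mFourierCoeff (EuclideanSpace.complexify ∘
        (G t - Torus.gradient (helmholtzPotential (G t)))) k j = 0 :=
    fun t => helmholtzPotential_spec (hG.isSmooth_slice (mem_univ t))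
  refine ⟨fun t x => G t x - Torus.gradient (helmholtzPotential (G t)) x,
    fun t => helmholtzPotential (G t), hG.sub (hφ.gradient uniqueDiffOn_univ), hφ, fun t => ?_,
    fun t => (hspec t).2.1, fun t x => by simp⟩
  exact isDivFree_of_sum_mul_mFourierCoeff_eq_zero
    ((hG.isSmooth_slice (mem_univ t)).sub (hspec t).1.gradient) (hspec t).2.2

end SpaceTime

end Literature.Analysis.FunctionSpaces.Torus

end
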